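import Mathlib
import HarnessLib
import Summits.AtomisticToContinuum.FouriersLaw.Theses.JunctionLocality
import Summits.AtomisticToContinuum.FouriersLaw.Theorems.JunctionLocalityConductanceLowerBoundContactCertificateTransmission
import Summits.AtomisticToContinuum.FouriersLaw.Theorems.JunctionLocalityConductanceLowerBoundContactCertificateBounds
import Summits.AtomisticToContinuum.FouriersLaw.Theorems.JunctionLocalityConductanceLowerBoundContactCertificateMoments

/-!
# Contact formation (stub `stub_contactFormation`, R4 of line `cold-bath-relocation-walk`, crux stmt-AtomisticToContinuum-11749)

THE ADJACENT-CONTACT DEVICE HAS CONDUCTANCE BOUNDED BELOW UNIFORMLY IN THE PASSIVE TAIL.  For the pinned anharmonic chain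
`pinnedChain ω₂ lam β γ` (all parameters `> 0`), `T > 0`, there is `c₀ = c₀(ω₂, lam, β, γ, T) > 0` such that for EVERY `L ≥ 2`
and every classical mean-zero `C² ∩ L²(μ_T)` solution `g` of the relocated forward problem with the hot bath on site `0` and the
cold bath on site `1` (`X_H g + γ(S_0 + S_1)g = −(p_0² − T)`), the Kubo conductance satisfies `γ(1 − γ⟨g, p_0² − T⟩/T²) ≥ c₀`.

Proof: the CURL CERTIFICATE (lead c2).  Transmission form `G = (γ³/T)·Y`, `Y = ‖p_0/γ − ∂_{p_0}g‖² + ‖∂_{p_1}g‖²`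
(`contact_transmission`).  The local test function `φ = p_0F_1 − p_1F_0` (`F_i = −∂_{q_i}H`) is a backward solution
`−X_Hφ + γ(S_0+S_1)φ = −(p_0A_0 − p_1A_1)`, `A_0 = γF_1 + X_HF_1`, `A_1 = γF_0 + X_HF_0` (`contact_testFunction_backward`), so the
cutoff-removed cross identity (`contact_cross`) gives `⟨φ, p_0² − T⟩ = ⟨g, p_0A_0 − p_1A_1⟩`; the left side vanishes (odd in `p`),
and one Gaussian integration by parts in each momentum with the curl identity `∂_{p_0}A_0 = ∂_{p_1}A_1 = V''(q_1 − q_0)`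
(`contact_integral_mul_twoMomenta`) turns the right side into `T(⟨∂_{p_0}g, A_0⟩ − ⟨∂_{p_1}g, A_1⟩)`, whence
(†) `⟨∂_{p_0}g, A_0⟩ = ⟨∂_{p_1}g, A_1⟩`.  The GAIN: `⟨∂_{p_1}g, A_1⟩ + ⟨p_0/γ − ∂_{p_0}g, A_0⟩ = ⟨p_0, A_0⟩/γ = (T/γ)E[V''(q_1−q_0)] ≥ T/γ`
(`V'' ≥ 1`); Cauchy–Schwarz: `(T/γ)² ≤ Y(‖A_0‖² + ‖A_1‖²) ≤ Y·2KM`, where `‖A_i‖² ≤ KM` UNIFORMLY IN `L` (`contact_realBounds`: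
`A_i² ≤ K S⁴` pointwise; `contact_gibbsPolynomialMoments`: `∫ S⁴ dμ_T ≤ M`, Gibbs moments of sites `0, 1, 2` only).  Hence
`G = (γ³/T)Y ≥ γT/(2KM) =: c₀`.

References: Rey-Bellet 2003 Rem. 4.4 (Kubo conductance); Eckmann–Pillet–Rey-Bellet 1999 §3; folklore.
-/

noncomputable section

open MeasureTheory Filter Topology
open scoped ContDiff
open Literature.MathematicalPhysics.KineticTheory.HeatConduction
open Summit.AtomisticToContinuum.FouriersLaw.Theorems.SuperadditiveResistance.DeviceLiouville
  (kin thermo kin_eq_sq continuous_kin liouvilleOp bathOp)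
open Summit.AtomisticToContinuum.FouriersLaw.Cruxes.SuperadditiveResistance.FloatingProbeBypassLaplacian
  (pinnedChain_memLp_two_snd pinnedChain_memLp_two_snd_sq)
open Literature.Barriers.AtomisticToContinuum (pinnedChain_deriv_deriv_U)

namespace Summit.AtomisticToContinuum.FouriersLaw.Cruxes.ConductanceLowerBound.ColdBathRelocationWalk

/-- **R4 — CONTACT FORMATION (uniform in the passive-tail length).**  The adjacent-contact device — hot bath on site `0`, cold bath
on site `1`, passive tail `2, …, L−1`, all at `T` — has Kubo conductance bounded below UNIFORMLY IN `L`: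
`∃ c₀ > 0 ∀ L ≥ 2, γ(1 − γ⟨g, p_0² − T⟩_{μ_T}/T²) ≥ c₀` for every classical mean-zero `C² ∩ L²(μ_T)` solution `g` of
`X_H g + γ(S_0 + S_1) g = −(p_0² − T)` (the curl certificate `φ = p_0F_1 − p_1F_0`; see the module docstring). [folklore] -/
theorem stub_contactFormation :
    ∀ (ω₂ lam β γ T : ℝ), 0 < ω₂ → 0 < lam → 0 < β → 0 < γ → 0 < T →
      ∃ c₀ : ℝ, 0 < c₀ ∧ ∀ (L : ℕ), 2 ≤ L → ∀ g : PhaseSpace L → ℝ, ContDiff ℝ 2 g →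
        MemLp g 2 ((pinnedChain ω₂ lam β γ).gibbsMeasure L T) →
        ∫ x, g x ∂((pinnedChain ω₂ lam β γ).gibbsMeasure L T) = 0 →
        (∀ x, liouvilleOp (pinnedChain ω₂ lam β γ) L g x + γ * (thermo L 0 T g x + thermo L 1 T g x) =
          -(kin L 0 x - T)) →
        c₀ ≤ γ * (1 - γ / T ^ 2 * ∫ x, g x * (kin L 0 x - T) ∂((pinnedChain ω₂ lam β γ).gibbsMeasure L T)) := by
  intro ω₂ lam β γ T hω hl hβ hγ hT
  obtain ⟨K, hK, hKb⟩ := contact_realBounds ω₂ lam β γ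
  obtain ⟨M, hM, hMb⟩ := contact_gibbsPolynomialMoments ω₂ lam β γ hω hl.le hβ.le T hT
  have hM0 : 0 < M := zero_lt_one.trans_le hM
  have hKM : 0 < 2 * K * M := by positivity
  refine ⟨γ * T / (2 * K * M), by positivity, fun L hL g hgC hgL2 _ hpde => ?_⟩
  -- ## sites, forces, the objects of the certificate
  have h0 : 0 < L := by omega
  have h1 : 1 < L := by omega
  obtain ⟨hQ0, j2, ε, hε0, hε1, hj2, hQ1⟩ :=
    contact_forcesClosedForm (ω₂ := ω₂) (lam := lam) (β := β) (γ := γ) hL (i0 := ⟨0, h0⟩) (i1 := ⟨1, h1⟩) rfl rfl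
  set i0 : Fin L := ⟨0, h0⟩ with hi0
  set i1 : Fin L := ⟨1, h1⟩ with hi1
  have h01 : i0 ≠ i1 := fun h => by simpa [hi0, hi1] using congrArg Fin.val h
  set P := pinnedChain ω₂ lam β γ with hP
  set μ := P.gibbsMeasure L T with hμ
  haveI : IsProbabilityMeasure μ := pinnedChain_isProbabilityMeasure_gibbsMeasure hω hl.le hβ.le γ L hT
  set F0 : PhaseSpace L → ℝ := fun y => -partialQ i0 (P.hamiltonian L) y with hF0def
  set F1 : PhaseSpace L → ℝ := fun y => -partialQ i1 (P.hamiltonian L) y with hF1def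
  have hF0 : F0 = fun y => -deriv P.U (y.1 i0) + deriv P.V (y.1 i1 - y.1 i0) := by
    funext y; simp only [hF0def, hQ0 y]; ring
  have hF1 : F1 = fun y => -deriv P.U (y.1 i1) - deriv P.V (y.1 i1 - y.1 i0) + ε * deriv P.V (y.1 j2 - y.1 i1) := by
    funext y; simp only [hF1def, hQ1 y]; ring
  have hF0H : ∀ x, F0 x = -partialQ i0 (P.hamiltonian L) x := fun x => rfl
  have hF1H : ∀ x, F1 x = -partialQ i1 (P.hamiltonian L) x := fun x => rfl
  set A0 : PhaseSpace L → ℝ := fun y => γ * F1 y + liouvilleOp P L F1 y with hA0def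
  set A1 : PhaseSpace L → ℝ := fun y => γ * F0 y + liouvilleOp P L F0 y with hA1def
  set φ : PhaseSpace L → ℝ := fun y => y.2 i0 * F1 y - y.2 i1 * F0 y with hφdef
  set kφ : PhaseSpace L → ℝ := fun y => y.2 i0 * A0 y - y.2 i1 * A1 y with hkφdef
  set W : PhaseSpace L → ℝ := fun y => deriv (deriv P.V) (y.1 i1 - y.1 i0) with hWdef
  -- ## regularity
  have hF0s : ContDiff ℝ 2 F0 := contact_contDiff_F0 hF0
  have hF1s : ContDiff ℝ 2 F1 := contact_contDiff_F1 hF1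
  have hddU : ContDiff ℝ 2 (deriv (deriv P.U)) := contact_contDiff_ddU ω₂ lam β γ
  have hddV : ContDiff ℝ 2 (deriv (deriv P.V)) := contact_contDiff_ddV ω₂ lam β γ
  have hX0fun : liouvilleOp P L F0 = fun y => -deriv (deriv P.U) (y.1 i0) * y.2 i0 +
      deriv (deriv P.V) (y.1 i1 - y.1 i0) * (y.2 i1 - y.2 i0) := funext (contact_liouvilleOp_F0 hF0)
  have hX1fun : liouvilleOp P L F1 = fun y => -deriv (deriv P.U) (y.1 i1) * y.2 i1 -
      deriv (deriv P.V) (y.1 i1 - y.1 i0) * (y.2 i1 - y.2 i0) +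
      ε * (deriv (deriv P.V) (y.1 j2 - y.1 i1) * (y.2 j2 - y.2 i1)) := funext (contact_liouvilleOp_F1 hF1)
  have hX0s : ContDiff ℝ 2 (liouvilleOp P L F0) := by rw [hX0fun]; fun_prop
  have hX1s : ContDiff ℝ 2 (liouvilleOp P L F1) := by rw [hX1fun]; fun_prop
  have hA0s : ContDiff ℝ 2 A0 := (contDiff_const.mul hF1s).add hX1s
  have hA1s : ContDiff ℝ 2 A1 := (contDiff_const.mul hF0s).add hX0s
  have hφs : ContDiff ℝ 2 φ := ((contact_contDiff_snd i0).mul hF1s).sub ((contact_contDiff_snd i1).mul hF0s)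
  have hkφs : ContDiff ℝ 2 kφ := ((contact_contDiff_snd i0).mul hA0s).sub ((contact_contDiff_snd i1).mul hA1s)
  have hpA0s : ContDiff ℝ 2 fun x : PhaseSpace L => x.2 i0 * A0 x := (contact_contDiff_snd i0).mul hA0s
  have hpA1s : ContDiff ℝ 2 fun x : PhaseSpace L => x.2 i1 * A1 x := (contact_contDiff_snd i1).mul hA1s
  have hWc : Continuous W := hddV.continuous.comp (by fun_prop)
  have hA0d : Differentiable ℝ A0 := hA0s.differentiable two_ne_zero
  have hA1d : Differentiable ℝ A1 := hA1s.differentiable two_ne_zero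
  -- ## pointwise polynomial bounds, hence `L`-uniform second moments
  have hbounds : ∀ x : PhaseSpace L,
      A0 x ^ 2 ≤ K * (1 + x.1 i0 ^ 2 + x.1 i1 ^ 2 + x.1 j2 ^ 2 + x.2 i0 ^ 2 + x.2 i1 ^ 2 + x.2 j2 ^ 2) ^ 4 ∧
      A1 x ^ 2 ≤ K * (1 + x.1 i0 ^ 2 + x.1 i1 ^ 2 + x.1 j2 ^ 2 + x.2 i0 ^ 2 + x.2 i1 ^ 2 + x.2 j2 ^ 2) ^ 4 ∧
      (x.2 i0 * A0 x) ^ 2 ≤ K * (1 + x.1 i0 ^ 2 + x.1 i1 ^ 2 + x.1 j2 ^ 2 + x.2 i0 ^ 2 + x.2 i1 ^ 2 + x.2 j2 ^ 2) ^ 4 ∧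
      (x.2 i1 * A1 x) ^ 2 ≤ K * (1 + x.1 i0 ^ 2 + x.1 i1 ^ 2 + x.1 j2 ^ 2 + x.2 i0 ^ 2 + x.2 i1 ^ 2 + x.2 j2 ^ 2) ^ 4 ∧
      φ x ^ 2 ≤ K * (1 + x.1 i0 ^ 2 + x.1 i1 ^ 2 + x.1 j2 ^ 2 + x.2 i0 ^ 2 + x.2 i1 ^ 2 + x.2 j2 ^ 2) ^ 4 ∧
      kφ x ^ 2 ≤ K * (1 + x.1 i0 ^ 2 + x.1 i1 ^ 2 + x.1 j2 ^ 2 + x.2 i0 ^ 2 + x.2 i1 ^ 2 + x.2 j2 ^ 2) ^ 4 ∧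
      W x ^ 2 ≤ K * (1 + x.1 i0 ^ 2 + x.1 i1 ^ 2 + x.1 j2 ^ 2 + x.2 i0 ^ 2 + x.2 i1 ^ 2 + x.2 j2 ^ 2) ^ 4 := by
    intro x
    have hb := hKb ε (x.1 i0) (x.1 i1) (x.1 j2) (x.2 i0) (x.2 i1) (x.2 j2) _ hε0 hε1 rfl
    have eF0 : F0 x = -(ω₂ * x.1 i0 + lam * x.1 i0 ^ 3) + ((x.1 i1 - x.1 i0) + β * (x.1 i1 - x.1 i0) ^ 3) := by
      rw [hF0]; simp only [hP, pinnedChain_deriv_U, pinnedChain_deriv_V]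
    have eF1 : F1 x = -(ω₂ * x.1 i1 + lam * x.1 i1 ^ 3) - ((x.1 i1 - x.1 i0) + β * (x.1 i1 - x.1 i0) ^ 3) +
        ε * ((x.1 j2 - x.1 i1) + β * (x.1 j2 - x.1 i1) ^ 3) := by
      rw [hF1]; simp only [hP, pinnedChain_deriv_U, pinnedChain_deriv_V]
    have eX0 : liouvilleOp P L F0 x = -(ω₂ + 3 * lam * x.1 i0 ^ 2) * x.2 i0 +
        (1 + 3 * β * (x.1 i1 - x.1 i0) ^ 2) * (x.2 i1 - x.2 i0) := by
      rw [hX0fun]; simp only [hP, pinnedChain_deriv_deriv_U, pinnedChain_deriv_deriv_V]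
    have eX1 : liouvilleOp P L F1 x = -(ω₂ + 3 * lam * x.1 i1 ^ 2) * x.2 i1 -
        (1 + 3 * β * (x.1 i1 - x.1 i0) ^ 2) * (x.2 i1 - x.2 i0) +
        ε * ((1 + 3 * β * (x.1 j2 - x.1 i1) ^ 2) * (x.2 j2 - x.2 i1)) := by
      rw [hX1fun]; simp only [hP, pinnedChain_deriv_deriv_U, pinnedChain_deriv_deriv_V]
    have eW : W x = 1 + 3 * β * (x.1 i1 - x.1 i0) ^ 2 := by
      simp only [hWdef, hP, pinnedChain_deriv_deriv_V]
    simp only [hA0def, hA1def, hφdef, hkφdef]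
    rw [eX0, eX1, eF0, eF1, eW]
    exact hb
  have mA0 := hMb L i0 i1 j2 K A0 hK.le hA0s.continuous fun x => (hbounds x).1
  have mA1 := hMb L i0 i1 j2 K A1 hK.le hA1s.continuous fun x => (hbounds x).2.1
  have mpA0 := hMb L i0 i1 j2 K (fun x => x.2 i0 * A0 x) hK.le hpA0s.continuous fun x => (hbounds x).2.2.1
  have mpA1 := hMb L i0 i1 j2 K (fun x => x.2 i1 * A1 x) hK.le hpA1s.continuous fun x => (hbounds x).2.2.2.1
  have mφ := hMb L i0 i1 j2 K φ hK.le hφs.continuous fun x => (hbounds x).2.2.2.2.1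
  have mkφ := hMb L i0 i1 j2 K kφ hK.le hkφs.continuous fun x => (hbounds x).2.2.2.2.2.1
  have mW := hMb L i0 i1 j2 K W hK.le hWc fun x => (hbounds x).2.2.2.2.2.2
  -- ## transmission form and the contact gradients
  obtain ⟨hga, hgb, -, -, hG⟩ := contact_transmission hω hl.le hβ.le hγ hT hL hgC hgL2 hpde
  -- ## the forward and the backward pair; the cross identity
  set B : Fin L → ℝ := fun i => (if i.val = 0 then 1 else 0) + (if i.val = 1 then 1 else 0) with hBdef
  have hBnn : ∀ i, 0 ≤ B i := fun i => contact_twoWeights_nonneg i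
  have hpg : ∀ x, 1 * liouvilleOp P L g x + γ * bathOp L B T g x = -(kin L 0 x - T) := fun x => by
    rw [one_mul, hBdef, contact_bathOp_two]; exact hpde x
  have hph : ∀ x, -1 * liouvilleOp P L φ x + γ * bathOp L B T φ x = -kφ x := fun x =>
    contact_testFunction_backward rfl rfl hF0 hF1 hF0H hF1H T x
  have hk0L2 : MemLp (fun x => kin L 0 x - T) 2 μ :=
    ((pinnedChain_memLp_two_snd_sq hω hl.le hβ.le γ L hT i0).sub (memLp_const T)).ae_eq
      (ae_of_all _ fun x => by simp [kin_eq_sq h0, hi0])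
  have hcross := contact_cross hω hl.le hβ.le γ L hT B hBnn hγ hgC hφs hgL2 hk0L2 mφ.1 mkφ.1 hpg hph
  have hodd : ∫ x, φ x * (kin L 0 x - T) ∂μ = 0 := by
    refine contact_integral_eq_zero_of_odd P L T fun x => ?_
    have hφodd := contact_phi_neg_momentum hF0 hF1 x
    show φ (x.1, -x.2) * (kin L 0 (x.1, -x.2) - T) = -(φ x * (kin L 0 x - T))
    rw [kin_eq_sq h0, kin_eq_sq h0]
    simp only [hφdef] at hφodd ⊢
    rw [hφodd]
    simp only [Pi.neg_apply]
    ring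
  -- ## (†) by one Gaussian integration by parts in each momentum, with the curl identity
  have hWa : ∀ x, partialP i0 A0 x = W x := contact_partialP_zero_A0 h01 hj2 hF1
  have hWb : ∀ x, partialP i1 A1 x = W x := contact_partialP_one_A1 h01 hF0
  have htwo := contact_integral_mul_twoMomenta hω hl.le hβ.le γ L hT i0 i1 hgC hA0d hA1d hWa hWb hgL2 hga hgb
    mA0.1 mA1.1 mpA0.1 mpA1.1 mW.1
  have hdag : ∫ x, partialP i0 g x * A0 x ∂μ = ∫ x, partialP i1 g x * A1 x ∂μ := by
    have h3 : T * ((∫ x, partialP i0 g x * A0 x ∂μ) - ∫ x, partialP i1 g x * A1 x ∂μ) = 0 := by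
      rw [← htwo, ← hcross, hodd]
    rcases mul_eq_zero.1 h3 with h4 | h4
    · exact absurd h4 hT.ne'
    · linarith
  -- ## the gain `⟨p_0, A_0⟩ = T E[V''(q_1 − q_0)] ≥ T`
  have iA0 : Integrable A0 μ := mA0.1.integrable one_le_two
  have ipA0 : Integrable (fun x => x.2 i0 * A0 x) μ := mpA0.1.integrable one_le_two
  have iW : Integrable W μ := mW.1.integrable one_le_two
  have hgain : ∫ x, x.2 i0 * A0 x ∂μ = T * ∫ x, W x ∂μ := by
    have idA0 : Integrable (partialP i0 A0) μ := iW.congr (ae_of_all _ fun x => (hWa x).symm)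
    rw [contact_integral_snd_mul hω hl.le hβ.le γ L hT i0 hA0d iA0 ipA0 idA0]
    congr 1
    exact integral_congr_ae (ae_of_all _ hWa)
  have hWge : 1 ≤ ∫ x, W x ∂μ := by
    have := integral_mono (integrable_const (1 : ℝ)) iW fun x => contact_one_le_ddV ω₂ lam γ hβ.le (x.1 i1 - x.1 i0)
    simpa using this
  -- ## Cauchy–Schwarz
  set u : PhaseSpace L → ℝ := fun x => γ⁻¹ * x.2 i0 - partialP i0 g x with hudef
  have hp0 : MemLp (fun x : PhaseSpace L => x.2 i0) 2 μ := pinnedChain_memLp_two_snd hω hl.le hβ.le γ L hT i0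
  have huL2 : MemLp u 2 μ := (hp0.const_mul γ⁻¹).sub hga
  have hIu : ∫ x, u x * A0 x ∂μ = γ⁻¹ * (∫ x, x.2 i0 * A0 x ∂μ) - ∫ x, partialP i0 g x * A0 x ∂μ := by
    have ia : Integrable (fun x => γ⁻¹ * (x.2 i0 * A0 x)) μ := ipA0.const_mul _
    have ib : Integrable (fun x => partialP i0 g x * A0 x) μ := hga.integrable_mul mA0.1
    rw [← integral_const_mul, ← integral_sub ia ib]
    exact integral_congr_ae (ae_of_all _ fun x => by simp only [hudef]; ring)
  have hCS := contact_sq_add_integral_mul_le hgb mA1.1 huL2 mA0.1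
  -- ## assembly
  have hΓ : T * γ⁻¹ ≤ (∫ x, partialP i1 g x * A1 x ∂μ) + ∫ x, u x * A0 x ∂μ := by
    rw [hIu, hgain, ← hdag]
    have : T * γ⁻¹ ≤ γ⁻¹ * (T * ∫ x, W x ∂μ) := by
      rw [show T * γ⁻¹ = γ⁻¹ * (T * 1) by ring]
      exact mul_le_mul_of_nonneg_left (mul_le_mul_of_nonneg_left hWge hT.le) (inv_nonneg.2 hγ.le)
    linarith
  have hΓ0 : 0 ≤ T * γ⁻¹ := by positivity
  have hΓ2 : (T * γ⁻¹) ^ 2 ≤ ((∫ x, partialP i1 g x * A1 x ∂μ) + ∫ x, u x * A0 x ∂μ) ^ 2 := pow_le_pow_left₀ hΓ0 hΓ 2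
  have hN0 : 0 ≤ (∫ x, partialP i1 g x ^ 2 ∂μ) + ∫ x, u x ^ 2 ∂μ :=
    add_nonneg (integral_nonneg fun x => sq_nonneg _) (integral_nonneg fun x => sq_nonneg _)
  have hDle : (∫ x, A1 x ^ 2 ∂μ) + ∫ x, A0 x ^ 2 ∂μ ≤ 2 * K * M := by linarith [mA0.2, mA1.2]
  have hY : (T * γ⁻¹) ^ 2 ≤ ((∫ x, partialP i1 g x ^ 2 ∂μ) + ∫ x, u x ^ 2 ∂μ) * (2 * K * M) :=
    hΓ2.trans (hCS.trans (mul_le_mul_of_nonneg_left hDle hN0))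
  have hY' : T ^ 2 ≤ γ ^ 2 * (((∫ x, u x ^ 2 ∂μ) + ∫ x, partialP i1 g x ^ 2 ∂μ) * (2 * K * M)) := by
    have e1 : (T * γ⁻¹) ^ 2 = T ^ 2 / γ ^ 2 := by field_simp
    rw [e1, div_le_iff₀ (by positivity)] at hY
    linarith
  rw [hG, div_le_iff₀ hKM]
  calc γ * T = γ / T * T ^ 2 := by field_simp
    _ ≤ γ / T * (γ ^ 2 * (((∫ x, u x ^ 2 ∂μ) + ∫ x, partialP i1 g x ^ 2 ∂μ) * (2 * K * M))) :=
        mul_le_mul_of_nonneg_left hY' (by positivity)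
    _ = γ ^ 3 / T * ((∫ x, u x ^ 2 ∂μ) + ∫ x, partialP i1 g x ^ 2 ∂μ) * (2 * K * M) := by ring

end Summit.AtomisticToContinuum.FouriersLaw.Cruxes.ConductanceLowerBound.ColdBathRelocationWalk

end
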